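import Summits.Ventures.YMGap.RobustBall.UniformPlaquetteDecayRows
import Summits.Ventures.YMGap.RobustBall.LoopObservable
import Summits.Ventures.YMGap.Thresholds.ZdSmoothingLipschitz
import HarnessLib

/-!
# Venture YMGap, track ROBUST-BALL (Y2) — uniform exponential decay of CONNECTED WILSON-LOOP CORRELATORS on the balls

HONEST FRAMING. WHAT THIS IS: a venture file (cell `pub-ymgap`, track Y2 ROBUST-BALL, seat rb-p1, theorems only). The Wilson-loop
observable `W_γ = Re tr U_γ / N` of ANY closed lattice walk `γ` (`loopTerm N 1 γ`) is a Lipschitz cylinder function on the links of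
`γ` with explicit constant `√N·|γ|` (`isLipschitzCylinder_loopTerm`: one-link Frobenius witness `mult_γ(y)/√N` of
`LoopObservable.lean`, Frobenius `≤ N ×` entry distance, McShane packaging `isLipschitzCylinder_of_dist_le`). Hence the uniform
currencies of `UniformMassGap.lean` give, for every member of a ball and every DLR state, the decay of the CONNECTED LOOP–LOOP
CORRELATOR — the observable whose decay rate is the glueball/torelon mass in the cell's FLOW data:
* `PerturbedClustering.abs_cov_loop_le` — clustering data `(m, A)`, two closed walks `γ₁, γ₂` with disjoint link sets and lengths
  `≤ n`: `|⟨W_{γ₁} W_{γ₂}⟩_μ − ⟨W_{γ₁}⟩_μ⟨W_{γ₂}⟩_μ| ≤ A n² (N n² + 1) e^{−m d(γ₁, γ₂)}` (`d` = sup-distance of the link base points);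
  `PerturbedClusteringS.abs_cov_loop_le` (tier 2);
* ball level, ONE bound for the whole ball: `UniformMassGapOnBallZd/ZdS/ZdG/LoopBall.abs_cov_loop_le`;
* cells (`SU(2)`, `d = 4`): loop ball `‖c‖_{log 2} ≤ 0.143`, `0 ≤ β_W ≤ 1/16`: `su2_loopBall_loop_decay_upTo_1_16` —
  `|Cov_μ(W_{γ₁}, W_{γ₂})| ≤ 16 n²(2n² + 1)·e^{−(log 2) d(γ₁,γ₂)}`; Wilson point `0 ≤ β_W ≤ 1/12`: `su2_wilson_loop_decay_upTo_oneTwelfth` —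
  `≤ 32 n²(2n² + 1)·e^{−(log 2) d(γ₁,γ₂)}` for EVERY DLR state of pure `SU(2)` on `ℤ⁴`.
WHAT THIS IS NOT: a lower bound on masses extracted from such correlators is NOT claimed beyond the displayed rate (Dobrushin
comparison); no area law / string tension statement here; strong-coupling LATTICE statements, nothing about the continuum limit or a
Clay-sense mass gap.
-/

noncomputable section

open MeasureTheory Filter Function ProbabilityTheory Real SimpleGraph
open scoped NNReal
open Literature.Probability.LatticeModels
open Literature.Probability.LatticeModels.DobrushinMetric
open Literature.MathematicalPhysics.QuantumLattice
open Literature.MathematicalPhysics.QuantumFieldTheory hiding ZdEdge Site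
open Literature.MathematicalPhysics.QuantumFieldTheory (walkEdges card_walkEdges_le_length)
open Summit.Ventures.YMGap.ZdSmoothing (suFrobDist_le_mul_dist_suEntries isLipschitzCylinder_of_dist_le)

namespace Summit.Ventures.YMGap.RobustBall

variable {d N : ℕ}

/-! ### Wilson loops are Lipschitz cylinder functions with constant `|c| √N |γ|` -/

/-- **The loop observable `c·Re tr U_γ/N` is a Lipschitz cylinder function** on the links of `γ` with constant `|c|·√N·|γ|`
(one-link Frobenius witness `|c| mult_γ(y)/√N`, `∑_y mult_γ(y) = |γ|`, Frobenius `≤ N ×` entry distance, McShane). [folklore] -/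
theorem isLipschitzCylinder_loopTerm (c : ℝ) {x : Literature.Probability.LatticeModels.Site d} (w : (zdGraph d).Walk x x) :
    IsLipschitzCylinder (fundamentalRep (Fin N)) (loopTerm (d := d) N c w) (walkEdges w)
      ⟨|c| * Real.sqrt N * w.length, by positivity⟩ := by
  classical
  refine isLipschitzCylinder_of_dist_le fun U V => ?_
  have hN0 : (0 : ℝ) ≤ N := Nat.cast_nonneg _
  have h1 := abs_sub_le_sum_of_dependsOn (dependsOn_loopTerm (N := N) (c := c) w) (isLipBound_loopTerm (N := N) (c := c) w) U V
  refine h1.trans ?_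
  set D : ℝ := dist (fun e : ↥(walkEdges w) => suEntries (U e)) (fun e : ↥(walkEdges w) => suEntries (V e)) with hD
  have hD0 : 0 ≤ D := dist_nonneg
  have hterm : ∀ y ∈ walkEdges w, |c| * (dartMult w y / Real.sqrt N) * suFrobDist (U y) (V y) ≤
      |c| * (dartMult w y / Real.sqrt N) * ((N : ℝ) * D) := by
    intro y hy
    refine mul_le_mul_of_nonneg_left ((suFrobDist_le_mul_dist_suEntries _ _).trans ?_) (by positivity)
    exact mul_le_mul_of_nonneg_left (dist_le_pi_dist (fun e : ↥(walkEdges w) => suEntries (U e))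
      (fun e : ↥(walkEdges w) => suEntries (V e)) ⟨y, hy⟩) hN0
  refine (Finset.sum_le_sum hterm).trans ?_
  have hsum : ∑ y ∈ walkEdges w, |c| * (dartMult w y / Real.sqrt N) * ((N : ℝ) * D) =
      |c| * ((N : ℝ) / Real.sqrt N) * D * ∑ y ∈ walkEdges w, (dartMult w y : ℝ) := by
    rw [Finset.mul_sum]
    exact Finset.sum_congr rfl fun y _ => by ring
  rw [hsum, show (∑ y ∈ walkEdges w, (dartMult w y : ℝ)) = w.length by exact_mod_cast sum_walkEdges_dartMult w]
  have hsq : (N : ℝ) / Real.sqrt N ≤ Real.sqrt N := by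
    rcases Nat.eq_zero_or_pos N with h0 | hpos
    · subst h0; simp
    · have hs : 0 < Real.sqrt N := Real.sqrt_pos.2 (by exact_mod_cast hpos)
      rw [div_le_iff₀ hs, Real.mul_self_sqrt hN0]
  have hlen : (0 : ℝ) ≤ w.length := Nat.cast_nonneg _
  calc |c| * ((N : ℝ) / Real.sqrt N) * D * w.length ≤ |c| * Real.sqrt N * D * w.length := by
        gcongr
    _ = |c| * Real.sqrt N * w.length * D := by ring

/-- The `L²` norm of a Wilson-loop observable (`c = 1`) is at most `1` under a probability measure. -/
theorem sqrt_integral_loopTerm_sq_le_one {x : Literature.Probability.LatticeModels.Site d} (w : (zdGraph d).Walk x x)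
    (μ : Measure (LGConfig d (SUN N))) [IsProbabilityMeasure μ] :
    Real.sqrt (∫ U, loopTerm (d := d) N 1 w U ^ 2 ∂μ) ≤ 1 := by
  have hb : ∀ U, |loopTerm (d := d) N 1 w U ^ 2| ≤ 1 := fun U => by
    rw [abs_pow]
    exact pow_le_one₀ (abs_nonneg _) ((abs_loopTerm_le w U).trans (by norm_num))
  have hint := norm_integral_le_of_norm_le_const (μ := μ) (f := fun U => loopTerm (d := d) N 1 w U ^ 2) (C := 1)
    (ae_of_all _ fun U => by simpa only [Real.norm_eq_abs] using hb U)
  have h1 : ∫ U, loopTerm (d := d) N 1 w U ^ 2 ∂μ ≤ 1 := (le_abs_self _).trans (by simpa [Real.norm_eq_abs] using hint)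
  calc Real.sqrt _ ≤ Real.sqrt 1 := Real.sqrt_le_sqrt h1
    _ = 1 := Real.sqrt_one

/-! ### Members with clustering data `(m, A)`: the connected loop–loop correlator -/

section Member

variable {β m A : ℝ} {W : Potential (ZdEdge d) (Matrix.specialUnitaryGroup (Fin N) ℂ)}
  {supp : Finset (ZdEdge d) → Finset (Finset (ZdEdge d))}

/-- Bookkeeping: `A n² e^{−mD}(K₁K₂ + B₁B₂) ≤ A n² (N n² + 1) e^{−mD}` for `Kᵢ = √N |γᵢ| ≤ √N n`, `Bᵢ ≤ 1`, `A ≥ 0`. -/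
theorem loop_bound_aux {A m D B₁ B₂ : ℝ} {n l₁ l₂ : ℕ} (hA : 0 ≤ A) (hB₁ : B₁ ≤ 1) (hB₂0 : 0 ≤ B₂)
    (hB₂ : B₂ ≤ 1) (h₁ : l₁ ≤ n) (h₂ : l₂ ≤ n) :
    A * (n : ℝ) ^ 2 * Real.exp (-m * D) * (Real.sqrt N * l₁ * (Real.sqrt N * l₂) + B₁ * B₂) ≤
      A * (n : ℝ) ^ 2 * ((N : ℝ) * (n : ℝ) ^ 2 + 1) * Real.exp (-m * D) := by
  have hN0 : (0 : ℝ) ≤ N := Nat.cast_nonneg _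
  have hl₁ : (l₁ : ℝ) ≤ n := by exact_mod_cast h₁
  have hl₂ : (l₂ : ℝ) ≤ n := by exact_mod_cast h₂
  have hK : Real.sqrt N * l₁ * (Real.sqrt N * l₂) ≤ (N : ℝ) * (n : ℝ) ^ 2 := by
    have e : Real.sqrt N * l₁ * (Real.sqrt N * l₂) = (N : ℝ) * ((l₁ : ℝ) * l₂) := by
      rw [show Real.sqrt N * l₁ * (Real.sqrt N * l₂) = Real.sqrt N * Real.sqrt N * ((l₁ : ℝ) * l₂) by ring,
        Real.mul_self_sqrt hN0]
    rw [e, sq]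
    exact mul_le_mul_of_nonneg_left (mul_le_mul hl₁ hl₂ (Nat.cast_nonneg _) (Nat.cast_nonneg _)) hN0
  have hB : B₁ * B₂ ≤ 1 := mul_le_one₀ hB₁ hB₂0 hB₂
  have hpre : 0 ≤ A * (n : ℝ) ^ 2 * Real.exp (-m * D) := by positivity
  calc A * (n : ℝ) ^ 2 * Real.exp (-m * D) * (Real.sqrt N * l₁ * (Real.sqrt N * l₂) + B₁ * B₂)
      ≤ A * (n : ℝ) ^ 2 * Real.exp (-m * D) * ((N : ℝ) * (n : ℝ) ^ 2 + 1) :=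
        mul_le_mul_of_nonneg_left (add_le_add hK hB) hpre
    _ = A * (n : ℝ) ^ 2 * ((N : ℝ) * (n : ℝ) ^ 2 + 1) * Real.exp (-m * D) := by ring

/-- **Connected loop–loop correlator of a member with clustering data `(m, A)`**: for every DLR state `μ`, two closed walks
`γ₁, γ₂` with disjoint link sets and lengths `≤ n`: `|Cov_μ(W_{γ₁}, W_{γ₂})| ≤ A n² (N n² + 1) e^{−m d(γ₁,γ₂)}` (`A ≥ 0`). [folklore] -/
theorem PerturbedClustering.abs_cov_loop_le (h : PerturbedClustering d N β W supp m A) (hA : 0 ≤ A)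
    {μ : Measure (LGConfig d (SUN N))} (hμ : μ ∈ perturbedGibbsMeasures (d := d) (fundamentalRep (Fin N)) (N * β) W supp)
    {x₁ x₂ : Literature.Probability.LatticeModels.Site d} (w₁ : (zdGraph d).Walk x₁ x₁) (w₂ : (zdGraph d).Walk x₂ x₂) {n : ℕ}
    (h₁ : w₁.length ≤ n) (h₂ : w₂.length ≤ n) (hdisj : Disjoint (walkEdges w₁) (walkEdges w₂)) :
    |cov[loopTerm (d := d) N 1 w₁, loopTerm (d := d) N 1 w₂; μ]| ≤
      A * (n : ℝ) ^ 2 * ((N : ℝ) * (n : ℝ) ^ 2 + 1) * Real.exp (-m * setDistEdges (walkEdges w₁) (walkEdges w₂)) := by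
  have hμ' : IsGibbsMeasure (perturbedYM (d := d) (fundamentalRep (Fin N)) (N * β) W supp) μ := hμ
  haveI := hμ'.isProbabilityMeasure
  have hL₁ := isLipschitzCylinder_loopTerm (d := d) (N := N) 1 w₁
  have hL₂ := isLipschitzCylinder_loopTerm (d := d) (N := N) 1 w₂
  simp only [abs_one, one_mul] at hL₁ hL₂
  have key := h μ hμ n _ _ _ _ _ _ ((card_walkEdges_le_length w₁).trans h₁) ((card_walkEdges_le_length w₂).trans h₂) hdisj
    hL₁ hL₂
  refine key.trans ?_
  exact loop_bound_aux hA (sqrt_integral_loopTerm_sq_le_one w₁ μ) (Real.sqrt_nonneg _)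
    (sqrt_integral_loopTerm_sq_le_one w₂ μ) h₁ h₂

/-- The tier-2 twin (summable specification). [folklore] -/
theorem PerturbedClusteringS.abs_cov_loop_le (h : PerturbedClusteringS d N β W m A) (hA : 0 ≤ A)
    {μ : Measure (LGConfig d (SUN N))} (hμ : μ ∈ perturbedGibbsMeasuresS (d := d) (fundamentalRep (Fin N)) (N * β) W)
    {x₁ x₂ : Literature.Probability.LatticeModels.Site d} (w₁ : (zdGraph d).Walk x₁ x₁) (w₂ : (zdGraph d).Walk x₂ x₂) {n : ℕ}
    (h₁ : w₁.length ≤ n) (h₂ : w₂.length ≤ n) (hdisj : Disjoint (walkEdges w₁) (walkEdges w₂)) :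
    |cov[loopTerm (d := d) N 1 w₁, loopTerm (d := d) N 1 w₂; μ]| ≤
      A * (n : ℝ) ^ 2 * ((N : ℝ) * (n : ℝ) ^ 2 + 1) * Real.exp (-m * setDistEdges (walkEdges w₁) (walkEdges w₂)) := by
  have hμ' : IsGibbsMeasure (perturbedYMS (d := d) (fundamentalRep (Fin N)) (N * β) W) μ := hμ
  haveI := hμ'.isProbabilityMeasure
  have hL₁ := isLipschitzCylinder_loopTerm (d := d) (N := N) 1 w₁
  have hL₂ := isLipschitzCylinder_loopTerm (d := d) (N := N) 1 w₂
  simp only [abs_one, one_mul] at hL₁ hL₂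
  have key := h μ hμ n _ _ _ _ _ _ ((card_walkEdges_le_length w₁).trans h₁) ((card_walkEdges_le_length w₂).trans h₂) hdisj
    hL₁ hL₂
  refine key.trans ?_
  exact loop_bound_aux hA (sqrt_integral_loopTerm_sq_le_one w₁ μ) (Real.sqrt_nonneg _)
    (sqrt_integral_loopTerm_sq_le_one w₂ μ) h₁ h₂

end Member

/-! ### The balls: ONE bound for every member and every DLR state -/

section Balls

variable {β ε₀ ε₁ R a Λ t w ε m A : ℝ}

/-- **UNIFORM LOOP–LOOP CORRELATOR DECAY ON THE TIER-1 BALL.** [folklore] -/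
theorem UniformMassGapOnBallZd.abs_cov_loop_le (h : UniformMassGapOnBallZd d N β ε₀ ε₁ R m A) (hA : 0 ≤ A)
    {W : Potential (ZdEdge d) (Matrix.specialUnitaryGroup (Fin N) ℂ)} {supp : Finset (ZdEdge d) → Finset (Finset (ZdEdge d))}
    (hW : MemBallZd ε₀ ε₁ R W supp) {μ : Measure (LGConfig d (SUN N))}
    (hμ : μ ∈ perturbedGibbsMeasures (d := d) (fundamentalRep (Fin N)) (N * β) W supp)
    {x₁ x₂ : Literature.Probability.LatticeModels.Site d} (w₁ : (zdGraph d).Walk x₁ x₁) (w₂ : (zdGraph d).Walk x₂ x₂) {n : ℕ}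
    (h₁ : w₁.length ≤ n) (h₂ : w₂.length ≤ n) (hdisj : Disjoint (walkEdges w₁) (walkEdges w₂)) :
    |cov[loopTerm (d := d) N 1 w₁, loopTerm (d := d) N 1 w₂; μ]| ≤
      A * (n : ℝ) ^ 2 * ((N : ℝ) * (n : ℝ) ^ 2 + 1) * Real.exp (-m * setDistEdges (walkEdges w₁) (walkEdges w₂)) :=
  (h.2 W supp hW).2.abs_cov_loop_le hA hμ w₁ w₂ h₁ h₂ hdisj

/-- **UNIFORM LOOP–LOOP CORRELATOR DECAY ON THE TIER-2 (WEIGHTED) BALL.** [folklore] -/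
theorem UniformMassGapOnBallZdS.abs_cov_loop_le (h : UniformMassGapOnBallZdS d N β a Λ t m A) (hA : 0 ≤ A)
    {W : Potential (ZdEdge d) (Matrix.specialUnitaryGroup (Fin N) ℂ)} (hW : MemBallZdS a Λ t W)
    {μ : Measure (LGConfig d (SUN N))} (hμ : μ ∈ perturbedGibbsMeasuresS (d := d) (fundamentalRep (Fin N)) (N * β) W)
    {x₁ x₂ : Literature.Probability.LatticeModels.Site d} (w₁ : (zdGraph d).Walk x₁ x₁) (w₂ : (zdGraph d).Walk x₂ x₂) {n : ℕ}
    (h₁ : w₁.length ≤ n) (h₂ : w₂.length ≤ n) (hdisj : Disjoint (walkEdges w₁) (walkEdges w₂)) :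
    |cov[loopTerm (d := d) N 1 w₁, loopTerm (d := d) N 1 w₂; μ]| ≤
      A * (n : ℝ) ^ 2 * ((N : ℝ) * (n : ℝ) ^ 2 + 1) * Real.exp (-m * setDistEdges (walkEdges w₁) (walkEdges w₂)) :=
  (h.2 W hW).2.abs_cov_loop_le hA hμ w₁ w₂ h₁ h₂ hdisj

/-- **UNIFORM LOOP–LOOP CORRELATOR DECAY ON ds-2's GAUGE BALL.** [folklore] -/
theorem UniformMassGapOnBallZdG.abs_cov_loop_le {R : ℕ} (h : UniformMassGapOnBallZdG d N β ε₀ ε₁ R m A) (hA : 0 ≤ A)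
    {W : Potential (ZdEdge d) (SUN N)} {supp : Finset (ZdEdge d) → Finset (Finset (ZdEdge d))}
    (hW : MemBallZdG ε₀ ε₁ R W supp) {μ : Measure (LGConfig d (SUN N))}
    (hμ : μ ∈ perturbedGibbsMeasures (d := d) (fundamentalRep (Fin N)) (N * β) W supp)
    {x₁ x₂ : Literature.Probability.LatticeModels.Site d} (w₁ : (zdGraph d).Walk x₁ x₁) (w₂ : (zdGraph d).Walk x₂ x₂) {n : ℕ}
    (h₁ : w₁.length ≤ n) (h₂ : w₂.length ≤ n) (hdisj : Disjoint (walkEdges w₁) (walkEdges w₂)) :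
    |cov[loopTerm (d := d) N 1 w₁, loopTerm (d := d) N 1 w₂; μ]| ≤
      A * (n : ℝ) ^ 2 * ((N : ℝ) * (n : ℝ) ^ 2 + 1) * Real.exp (-m * setDistEdges (walkEdges w₁) (walkEdges w₂)) :=
  (h.2 W supp hW).2.abs_cov_loop_le hA hμ w₁ w₂ h₁ h₂ hdisj

/-- **UNIFORM LOOP–LOOP CORRELATOR DECAY ON THE LOOP-ACTION NORM BALL `‖c‖_w ≤ ε`.** [folklore] -/
theorem UniformMassGapOnLoopBall.abs_cov_loop_le (h : UniformMassGapOnLoopBall d N β w ε m A) (hA : 0 ≤ A)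
    {ι : Type} {γ : ι → ZdLoop d} {c : ι → ℝ} (hfin : ∀ X, {i | walkEdges (γ i).walk = X}.Finite) (hn : LoopNormLE w γ c ε)
    {μ : Measure (LGConfig d (SUN N))}
    (hμ : μ ∈ perturbedGibbsMeasuresS (d := d) (fundamentalRep (Fin N)) (N * β) (loopFamilyAction (d := d) N γ c))
    {x₁ x₂ : Literature.Probability.LatticeModels.Site d} (w₁ : (zdGraph d).Walk x₁ x₁) (w₂ : (zdGraph d).Walk x₂ x₂) {n : ℕ}
    (h₁ : w₁.length ≤ n) (h₂ : w₂.length ≤ n) (hdisj : Disjoint (walkEdges w₁) (walkEdges w₂)) :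
    |cov[loopTerm (d := d) N 1 w₁, loopTerm (d := d) N 1 w₂; μ]| ≤
      A * (n : ℝ) ^ 2 * ((N : ℝ) * (n : ℝ) ^ 2 + 1) * Real.exp (-m * setDistEdges (walkEdges w₁) (walkEdges w₂)) :=
  (h.2 ι γ c hfin hn).2.abs_cov_loop_le hA hμ w₁ w₂ h₁ h₂ hdisj

end Balls

/-! ### Cells: `SU(2)`, `d = 4` -/

/-- **LOOP BALL `‖c‖_{log 2} ≤ 0.143`, `0 ≤ β_W ≤ 1/16`**: for EVERY generic Wilson-type loop action (finite carrier fibres), EVERY DLR state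
and every two closed walks with disjoint link sets and lengths `≤ n`:
`|Cov_μ(W_{γ₁}, W_{γ₂})| ≤ 16 n² (2n² + 1) · e^{−(log 2)·d(γ₁,γ₂)}` (`W_γ = ½ Re tr U_γ`). [folklore] -/
theorem su2_loopBall_loop_decay_upTo_1_16 {βW : ℝ} (h0 : 0 ≤ βW) (h : βW ≤ 1 / 16)
    {ι : Type} {γ : ι → ZdLoop 4} {c : ι → ℝ} (hfin : ∀ X, {i | walkEdges (γ i).walk = X}.Finite)
    (hn : LoopNormLE (Real.log 2) γ c (143 / 1000)) {μ : Measure (LGConfig 4 (SUN 2))}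
    (hμ : μ ∈ perturbedGibbsMeasuresS (d := 4) (fundamentalRep (Fin 2)) (2 * (βW / 4)) (loopFamilyAction (d := 4) 2 γ c))
    {x₁ x₂ : Literature.Probability.LatticeModels.Site 4} (w₁ : (zdGraph 4).Walk x₁ x₁) (w₂ : (zdGraph 4).Walk x₂ x₂) {n : ℕ}
    (h₁ : w₁.length ≤ n) (h₂ : w₂.length ≤ n) (hdisj : Disjoint (walkEdges w₁) (walkEdges w₂)) :
    |cov[loopTerm (d := 4) 2 1 w₁, loopTerm (d := 4) 2 1 w₂; μ]| ≤
      16 * (n : ℝ) ^ 2 * (2 * (n : ℝ) ^ 2 + 1) * Real.exp (-Real.log 2 * setDistEdges (walkEdges w₁) (walkEdges w₂)) := by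
  have h' := (su2_uniformLoopBall_upTo_1_16 h0 h).abs_cov_loop_le (by norm_num) hfin hn hμ w₁ w₂ h₁ h₂ hdisj
  simpa only [Nat.cast_ofNat] using h'

/-- **PURE `SU(2)` WILSON ON `ℤ⁴`, `0 ≤ β_W ≤ 1/12`, EVERY DLR STATE**: for every two closed walks with disjoint link sets and
lengths `≤ n`, `|Cov_μ(W_{γ₁}, W_{γ₂})| ≤ 32 n² (2n² + 1) · e^{−(log 2)·d(γ₁,γ₂)}`. [folklore] -/
theorem su2_wilson_loop_decay_upTo_oneTwelfth {βW : ℝ} (h0 : 0 ≤ βW) (h : βW ≤ 1 / 12)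
    {μ : Measure (LGConfig 4 (SUN 2))} (hμ : μ ∈ ymGibbsMeasures (d := 4) (fundamentalRep (Fin 2)) (βW / 2))
    {x₁ x₂ : Literature.Probability.LatticeModels.Site 4} (w₁ : (zdGraph 4).Walk x₁ x₁) (w₂ : (zdGraph 4).Walk x₂ x₂) {n : ℕ}
    (h₁ : w₁.length ≤ n) (h₂ : w₂.length ≤ n) (hdisj : Disjoint (walkEdges w₁) (walkEdges w₂)) :
    |cov[loopTerm (d := 4) 2 1 w₁, loopTerm (d := 4) 2 1 w₂; μ]| ≤
      32 * (n : ℝ) ^ 2 * (2 * (n : ℝ) ^ 2 + 1) * Real.exp (-Real.log 2 * setDistEdges (walkEdges w₁) (walkEdges w₂)) := by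
  have hμ' : μ ∈ perturbedGibbsMeasures (d := 4) (fundamentalRep (Fin 2)) (2 * (βW / 4)) 0
      (fun _ => (∅ : Finset (Finset (ZdEdge 4)))) := by
    rw [perturbedGibbsMeasures_zero]
    have e : (2 : ℝ) * (βW / 4) = βW / 2 := by ring
    rwa [e]
  have h' := (su2_wilson_clustering_upTo_oneTwelfth h0 h).abs_cov_loop_le (by norm_num) hμ' w₁ w₂ h₁ h₂ hdisj
  simpa only [Nat.cast_ofNat] using h'

end Summit.Ventures.YMGap.RobustBall

end
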